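import Summits.CriticalPhenomena.PercolationContinuityZ3.Theorems.PercNearOneGluingNoHeavyLowerTailKnQuestion8CoefficientwiseCoreClassKernelMixFull
import HarnessLib

/-!
# The path-contact transfer: increasing-event transfer along a fixed path (the contact cell of the SKEW form)

Support file (`--supports stmt-CriticalPhenomena-4575`, closed), prover `prim-cplus-coupling` (gen 37).  No definitions, no notations, no named facts,
no sorries; standard axioms.  Memo `prim-cplus-coupling/A5-COUPLING-gen37.md` §2.  Companion of `…CoreClassKernelMixDoubleRoot` (the cube lemma).

Context.  The hat 2-sum `KB-MIX-FULL(a~{u,v} + E; a, b)` splits by the colours of `au, av` into the pieces DOUBLE-ROOT (`RR`), SKEW (`RB`, `BR`) and a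
trivial one (gen 36 memo §5.1).  SKEW(E; u, v; b) = `Σ_ω h(C_u ω ∪ C_b ω)k(…) + Σ_{b ∉ C_u ω, v ∉ C_b(E∖ω)} (hᵃ(C_u ω) − hᵇ(C_b(E∖ω)))(kᵃ(…) − kᵇ(…))`;
its wall part `{u ∉ C_b(E∖ω)}` is paid by a proper domination map of `(E; u, b)`, and its CONTACT CELL `{u ∈ C_b(E∖ω), v ∉ C_b(E∖ω)}` is an instance of the
INCREASING-EVENT TRANSFER (memo §2, census-clean for all graphs `n ≤ 6`): `Σ_{ω ∈ 𝒱 : b ∈ X∖Y} hk(X) + Σ_{ω ∈ 𝒱 : b ∈ Y∖X} (hᵃX − hᵇY)(kᵃX − kᵇY) ≥ 0` for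
EVERY up-set `𝒱` (`X = C_u ω`, `Y = C_u(E∖ω)`).  This file proves the form of it that the cycle / bundle case needs, for EVERY graph:
* `Coefficientwise.cube_upset_transfer_slack` — the cube lemma of `…KernelMixDoubleRoot` with its pointwise slack `(A−a)(C−c) + p̄q̄` kept.
* `Coefficientwise.sdiff_sdiff_union_eq` — bookkeeping: `((E∖W)∖η) ∪ W = E∖η`.
* `Coefficientwise.pathContact_transfer` — **PATH-CONTACT TRANSFER**: for a fixed edge set `W ⊆ E` (a `u–b` path) and ANY up-closed event `𝒱` on the
  colourings `η` of `E ∖ W` (read with `W` blue), the anti-terms `(hᵃ(C_u η) − hᵇ(C_u(E∖η)))(kᵃ(C_u η) − kᵇ(C_u(E∖η)))` over `{η ∈ 𝒱 : b ∉ C_u η}` are paid by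
  ONE copy of the supply `h(S)k(S)` (`S = C_u ∪ C_b`) at the colourings `η ∪ W` (`η ∈ 𝒱`; `W` recoloured red — a monotone injection, so compatible with
  every up-set) plus one copy at the 'phantom' colourings `{η ∈ 𝒱 : b ∈ C_u η}`.  Proof: the cube lemma on `2^{E∖W}` (the blue cluster `C_u(E∖η)` IS the
  red cluster of the complementary point `((E∖W)∖η) ∪ W`), phantoms bounded by `ac + p̄q̄`.  For a cycle through `u, b, v` with `W` the `u–b` arc avoiding
  `v` and `𝒱 = {v ∉ C_u(E∖η)}` this is exactly the SKEW contact cell (memo §2.3).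
[cite: KozmaNitzan2024, Questions 8–9 (§5.5 p. 36) (context: the Question-8 pocket covariance programme)]
-/

namespace Summit.CriticalPhenomena.PercolationContinuityZ3.Theorems

open Finset Literature.Probability.Percolation

namespace Coefficientwise

variable {ι V : Type*}

/-- **The cube lemma with slack.**  As `cube_upset_transfer`, keeping the pointwise slack: for an up-closed `𝒱` and monotone `0 ≤ a`, `p ≤ A`, `0 ≤ c`, `q ≤ C`,
`Σ_{ω ∈ 𝒱} [(A − a)(C − c)(ω) + p(E∖ω)q(E∖ω)] ≤ Σ_{ω ∈ 𝒱} [A(ω)C(ω) + (a(ω) − p(E∖ω))(c(ω) − q(E∖ω))]`.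
[cite: KozmaNitzan2024, Questions 8–9 (§5.5 p. 36) (context; mechanism: Harris 1960)] -/
theorem cube_upset_transfer_slack [DecidableEq ι] (E : Finset ι) (𝒱 : Finset ι → Prop) [DecidablePred 𝒱]
    (hV : ∀ ⦃s t : Finset ι⦄, s ⊆ t → 𝒱 s → 𝒱 t)
    (a p A c q C : Finset ι → ℝ) (ma : Monotone a) (mp : Monotone p) (mc : Monotone c) (mq : Monotone q)
    (a0 : ∀ s, 0 ≤ a s) (pA : ∀ s, p s ≤ A s) (c0 : ∀ s, 0 ≤ c s) (qC : ∀ s, q s ≤ C s) :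
    ∑ ω ∈ E.powerset, (if 𝒱 ω then (A ω - a ω) * (C ω - c ω) + p (E \ ω) * q (E \ ω) else 0)
      ≤ ∑ ω ∈ E.powerset, (if 𝒱 ω then A ω * C ω + (a ω - p (E \ ω)) * (c ω - q (E \ ω)) else 0) := by
  set F₁ : Finset ι → ℝ := fun ω => if 𝒱 ω then a ω else 0 with hF₁
  set F₂ : Finset ι → ℝ := fun ω => if 𝒱 ω then c ω else 0 with hF₂
  have mF₁ : Monotone F₁ := by
    intro s t hst
    simp only [hF₁]
    by_cases hs : 𝒱 s
    · rw [if_pos hs, if_pos (hV hst hs)]; exact ma hst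
    · rw [if_neg hs]
      by_cases ht : 𝒱 t
      · rw [if_pos ht]; exact a0 t
      · rw [if_neg ht]
  have mF₂ : Monotone F₂ := by
    intro s t hst
    simp only [hF₂]
    by_cases hs : 𝒱 s
    · rw [if_pos hs, if_pos (hV hst hs)]; exact mc hst
    · rw [if_neg hs]
      by_cases ht : 𝒱 t
      · rw [if_pos ht]; exact c0 t
      · rw [if_neg ht]
  have h1 := sum_mul_sdiff_le_sum_mul E F₁ q mF₁ mq
  have h2 := sum_mul_sdiff_le_sum_mul E F₂ p mF₂ mp
  have key : ∀ ω ∈ E.powerset, (if 𝒱 ω then A ω * C ω + (a ω - p (E \ ω)) * (c ω - q (E \ ω)) else 0)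
      = (if 𝒱 ω then A ω * C ω + a ω * c ω + p (E \ ω) * q (E \ ω) - a ω * q ω - c ω * p ω else 0)
        + (F₁ ω * q ω - F₁ ω * q (E \ ω)) + (F₂ ω * p ω - F₂ ω * p (E \ ω)) := by
    intro ω _
    simp only [hF₁, hF₂]
    by_cases hv : 𝒱 ω
    · simp only [if_pos hv]; ring
    · simp only [if_neg hv]; ring
  rw [Finset.sum_congr rfl key, Finset.sum_add_distrib, Finset.sum_add_distrib, Finset.sum_sub_distrib, Finset.sum_sub_distrib]
  have pt : ∑ ω ∈ E.powerset, (if 𝒱 ω then (A ω - a ω) * (C ω - c ω) + p (E \ ω) * q (E \ ω) else 0)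
      ≤ ∑ ω ∈ E.powerset, (if 𝒱 ω then A ω * C ω + a ω * c ω + p (E \ ω) * q (E \ ω) - a ω * q ω - c ω * p ω else 0) := by
    refine Finset.sum_le_sum fun ω _ => ?_
    by_cases hv : 𝒱 ω
    · rw [if_pos hv, if_pos hv]
      have e1 : 0 ≤ a ω * (C ω - q ω) := mul_nonneg (a0 ω) (sub_nonneg.mpr (qC ω))
      have e2 : 0 ≤ c ω * (A ω - p ω) := mul_nonneg (c0 ω) (sub_nonneg.mpr (pA ω))
      nlinarith [e1, e2]
    · rw [if_neg hv, if_neg hv]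
  linarith

/-- Colouring a fixed edge set `W ⊆ E` red on top of a colouring `η` of `E ∖ W`: the complement of `(E ∖ W) ∖ η` followed by `W` is `E ∖ η`.
[cite: KozmaNitzan2024, §5.5 (context only; bookkeeping)] -/
theorem sdiff_sdiff_union_eq [DecidableEq ι] (E W η : Finset ι) (hW : W ⊆ E) (hη : η ⊆ E \ W) :
    ((E \ W) \ η) ∪ W = E \ η := by
  ext i
  simp only [Finset.mem_union, Finset.mem_sdiff]
  constructor
  · rintro (⟨⟨hiE, _⟩, hiη⟩ | hiW)
    · exact ⟨hiE, hiη⟩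
    · exact ⟨hW hiW, fun hiη => (Finset.mem_sdiff.mp (hη hiη)).2 hiW⟩
  · rintro ⟨hiE, hiη⟩
    by_cases hiW : i ∈ W
    · exact Or.inr hiW
    · exact Or.inl ⟨⟨hiE, hiW⟩, hiη⟩

open Classical in
/-- **THE PATH-CONTACT TRANSFER (any graph).**  Edge set `E`, root `u`, observer `b`, a fixed edge set `W ⊆ E` (in applications a `u–b` path), an
up-closed event `𝒱` on the colourings `η ⊆ E ∖ W` of the other edges (read with `W` BLUE: red cluster `C_u η`, blue cluster `C_u(E ∖ η)`); monotone
`h, k`, monotone levels `0 ≤ hᵃ, hᵇ ≤ h`, `0 ≤ kᵃ, kᵇ ≤ k`; `S(ω) = C_u ω ∪ C_b ω`.  Then the anti-terms at the colourings of `𝒱` in which `u` does NOT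
reach `b` in red are paid by the supply at `η ∪ W` (`W` recoloured red) over `𝒱` plus the supply at the colourings of `𝒱` in which `u` DOES reach `b`:
`0 ≤ Σ_{η ∈ 𝒱} h(S(η ∪ W))k(S(η ∪ W)) + Σ_{η ∈ 𝒱, b ∈ C_u η} h(S η)k(S η) + Σ_{η ∈ 𝒱, b ∉ C_u η} (hᵃ(C_u η) − hᵇ(C_u(E∖η)))(kᵃ(C_u η) − kᵇ(C_u(E∖η)))`.
Proof: the cube lemma on `2^{E∖W}` with `a = hᵃ∘C_u`, `A = h∘S(· ∪ W)`, `p = hᵇ∘C_u(· ∪ W)` (note `C_u(E ∖ η) = C_u(((E∖W)∖η) ∪ W)`), the phantom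
terms (`b ∈ C_u η`) bounded by `ac + p̄q̄`.  This is the INCREASING-EVENT TRANSFER of memo §2 along a fixed path; it pays the contact cell of SKEW.
[cite: KozmaNitzan2024, Questions 8–9 (§5.5 p. 36) (context)] -/
theorem pathContact_transfer (ends : ι → Sym2 V) (E W : Finset ι) (hW : W ⊆ E) (u b : V)
    (𝒱 : Finset ι → Prop) (hV : ∀ ⦃s t : Finset ι⦄, s ⊆ t → 𝒱 s → 𝒱 t)
    (h k ha hb ka kb : Set V → ℝ)
    (hh : Monotone h) (hk : Monotone k) (mha : Monotone ha) (mhb : Monotone hb) (mka : Monotone ka) (mkb : Monotone kb)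
    (ha0 : ∀ X, 0 ≤ ha X) (hah : ∀ X, ha X ≤ h X) (hb0 : ∀ X, 0 ≤ hb X) (hbh : ∀ X, hb X ≤ h X)
    (ka0 : ∀ X, 0 ≤ ka X) (kak : ∀ X, ka X ≤ k X) (kb0 : ∀ X, 0 ≤ kb X) (kbk : ∀ X, kb X ≤ k X) :
    0 ≤ (∑ η ∈ (E \ W).powerset, if 𝒱 η then
          h (openCluster (ends '' (↑(η ∪ W) : Set ι)) u ∪ openCluster (ends '' (↑(η ∪ W) : Set ι)) b) *
            k (openCluster (ends '' (↑(η ∪ W) : Set ι)) u ∪ openCluster (ends '' (↑(η ∪ W) : Set ι)) b) else 0)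
      + (∑ η ∈ (E \ W).powerset, if 𝒱 η ∧ b ∈ openCluster (ends '' (↑η : Set ι)) u then
          h (openCluster (ends '' (↑η : Set ι)) u ∪ openCluster (ends '' (↑η : Set ι)) b) *
            k (openCluster (ends '' (↑η : Set ι)) u ∪ openCluster (ends '' (↑η : Set ι)) b) else 0)
      + ∑ η ∈ (E \ W).powerset, if 𝒱 η ∧ b ∉ openCluster (ends '' (↑η : Set ι)) u then
          (ha (openCluster (ends '' (↑η : Set ι)) u) - hb (openCluster (ends '' (↑(E \ η) : Set ι)) u)) *
            (ka (openCluster (ends '' (↑η : Set ι)) u) - kb (openCluster (ends '' (↑(E \ η) : Set ι)) u)) else 0 := by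
  set C : Finset ι → V → Set V := fun ω x => openCluster (ends '' (↑ω : Set ι)) x with hC
  set S : Finset ι → Set V := fun ω => C ω u ∪ C ω b with hS
  set Q : Finset ι := E \ W with hQ
  change 0 ≤ (∑ η ∈ Q.powerset, if 𝒱 η then h (S (η ∪ W)) * k (S (η ∪ W)) else 0)
      + (∑ η ∈ Q.powerset, if 𝒱 η ∧ b ∈ C η u then h (S η) * k (S η) else 0)
      + ∑ η ∈ Q.powerset, if 𝒱 η ∧ b ∉ C η u then (ha (C η u) - hb (C (E \ η) u)) * (ka (C η u) - kb (C (E \ η) u)) else 0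
  have hCmono : ∀ {ω ω' : Finset ι} (x : V), ω ⊆ ω' → C ω x ⊆ C ω' x := fun x hle => openCluster_image_mono ends hle x
  have hh0 : ∀ X, 0 ≤ h X := fun X => le_trans (ha0 X) (hah X)
  have hk0 : ∀ X, 0 ≤ k X := fun X => le_trans (ka0 X) (kak X)
  -- the cube lemma data
  set fa : Finset ι → ℝ := fun η => ha (C η u) with hfa
  set fc : Finset ι → ℝ := fun η => ka (C η u) with hfc
  set fp : Finset ι → ℝ := fun η => hb (C (η ∪ W) u) with hfp
  set fq : Finset ι → ℝ := fun η => kb (C (η ∪ W) u) with hfq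
  set fA : Finset ι → ℝ := fun η => h (S (η ∪ W)) with hfA
  set fC : Finset ι → ℝ := fun η => k (S (η ∪ W)) with hfC
  have huS : ∀ η, C η u ⊆ S (η ∪ W) := fun η => le_trans (hCmono u Finset.subset_union_left) Set.subset_union_left
  have huS' : ∀ η, C (η ∪ W) u ⊆ S (η ∪ W) := fun η => Set.subset_union_left
  have slack := cube_upset_transfer_slack Q 𝒱 hV fa fp fA fc fq fC
    (fun s t hst => mha (hCmono u hst)) (fun s t hst => mhb (hCmono u (Finset.union_subset_union hst (le_refl W))))
    (fun s t hst => mka (hCmono u hst)) (fun s t hst => mkb (hCmono u (Finset.union_subset_union hst (le_refl W))))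
    (fun s => ha0 _) (fun s => le_trans (hbh _) (hh (huS' s)))
    (fun s => ka0 _) (fun s => le_trans (kbk _) (hk (huS' s)))
  -- the complement identity `C_u(((E∖W)∖η) ∪ W) = C_u(E∖η)` inside the cube lemma's terms
  have hcomp : ∀ η ∈ Q.powerset, C ((Q \ η) ∪ W) u = C (E \ η) u := by
    intro η hη
    rw [hQ, sdiff_sdiff_union_eq E W η hW (Finset.mem_powerset.mp hη)]
  have slack' : ∑ η ∈ Q.powerset, (if 𝒱 η then (fA η - fa η) * (fC η - fc η) + hb (C (E \ η) u) * kb (C (E \ η) u) else 0)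
      ≤ ∑ η ∈ Q.powerset, (if 𝒱 η then fA η * fC η + (fa η - hb (C (E \ η) u)) * (fc η - kb (C (E \ η) u)) else 0) := by
    have l1 : ∑ η ∈ Q.powerset, (if 𝒱 η then (fA η - fa η) * (fC η - fc η) + hb (C (E \ η) u) * kb (C (E \ η) u) else 0)
        = ∑ η ∈ Q.powerset, (if 𝒱 η then (fA η - fa η) * (fC η - fc η) + fp (Q \ η) * fq (Q \ η) else 0) := by
      refine Finset.sum_congr rfl fun η hη => ?_
      simp only [hfp, hfq, hcomp η hη]
    have l2 : ∑ η ∈ Q.powerset, (if 𝒱 η then fA η * fC η + (fa η - hb (C (E \ η) u)) * (fc η - kb (C (E \ η) u)) else 0)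
        = ∑ η ∈ Q.powerset, (if 𝒱 η then fA η * fC η + (fa η - fp (Q \ η)) * (fc η - fq (Q \ η)) else 0) := by
      refine Finset.sum_congr rfl fun η hη => ?_
      simp only [hfp, hfq, hcomp η hη]
    rw [l1, l2]; exact slack
  -- split the cube lemma's anti-sum into the demand part (`b ∉ C_u η`) and the phantom part (`b ∈ C_u η`)
  have hsplit : ∑ η ∈ Q.powerset, (if 𝒱 η then fA η * fC η + (fa η - hb (C (E \ η) u)) * (fc η - kb (C (E \ η) u)) else 0)
      = (∑ η ∈ Q.powerset, if 𝒱 η then fA η * fC η else 0)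
        + (∑ η ∈ Q.powerset, if 𝒱 η ∧ b ∉ C η u then (fa η - hb (C (E \ η) u)) * (fc η - kb (C (E \ η) u)) else 0)
        + ∑ η ∈ Q.powerset, if 𝒱 η ∧ b ∈ C η u then (fa η - hb (C (E \ η) u)) * (fc η - kb (C (E \ η) u)) else 0 := by
    rw [← Finset.sum_add_distrib, ← Finset.sum_add_distrib]
    refine Finset.sum_congr rfl fun η _ => ?_
    by_cases hv : 𝒱 η
    · by_cases hb' : b ∈ C η u
      · rw [if_pos hv, if_pos hv, if_neg (fun hx => hx.2 hb'), if_pos ⟨hv, hb'⟩]; ring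
      · rw [if_pos hv, if_pos hv, if_pos ⟨hv, hb'⟩, if_neg (fun hx => hb' hx.2)]; ring
    · rw [if_neg hv, if_neg hv, if_neg (fun hx => hv hx.1), if_neg (fun hx => hv hx.1)]; ring
  have hsplit2 : ∑ η ∈ Q.powerset, (if 𝒱 η then (fA η - fa η) * (fC η - fc η) + hb (C (E \ η) u) * kb (C (E \ η) u) else 0)
      ≥ ∑ η ∈ Q.powerset, (if 𝒱 η ∧ b ∈ C η u then hb (C (E \ η) u) * kb (C (E \ η) u) else 0) := by
    rw [ge_iff_le]
    refine Finset.sum_le_sum fun η _ => ?_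
    by_cases hv : 𝒱 η
    · by_cases hb' : b ∈ C η u
      · rw [if_pos ⟨hv, hb'⟩, if_pos hv]
        nlinarith [mul_nonneg (sub_nonneg.mpr (le_trans (hah (C η u)) (hh (huS η)))) (sub_nonneg.mpr (le_trans (kak (C η u)) (hk (huS η))))]
      · rw [if_neg (fun hx => hb' hx.2), if_pos hv]
        nlinarith [mul_nonneg (sub_nonneg.mpr (le_trans (hah (C η u)) (hh (huS η)))) (sub_nonneg.mpr (le_trans (kak (C η u)) (hk (huS η)))),
          mul_nonneg (hb0 (C (E \ η) u)) (kb0 (C (E \ η) u))]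
    · rw [if_neg (fun hx => hv hx.1), if_neg hv]
  -- the phantom terms: `(a − p̄)(c − q̄) ≤ ac + p̄q̄ ≤ h(S η)k(S η) + p̄q̄`
  have hph : ∑ η ∈ Q.powerset, (if 𝒱 η ∧ b ∈ C η u then (fa η - hb (C (E \ η) u)) * (fc η - kb (C (E \ η) u)) else 0)
      ≤ (∑ η ∈ Q.powerset, if 𝒱 η ∧ b ∈ C η u then h (S η) * k (S η) else 0)
        + ∑ η ∈ Q.powerset, (if 𝒱 η ∧ b ∈ C η u then hb (C (E \ η) u) * kb (C (E \ η) u) else 0) := by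
    rw [← Finset.sum_add_distrib]
    refine Finset.sum_le_sum fun η _ => ?_
    by_cases hv : 𝒱 η ∧ b ∈ C η u
    · rw [if_pos hv, if_pos hv, if_pos hv]
      simp only [hfa, hfc]
      have e1 : ha (C η u) * ka (C η u) ≤ h (S η) * k (S η) :=
        mul_le_mul (le_trans (hah _) (hh Set.subset_union_left)) (le_trans (kak _) (hk Set.subset_union_left)) (ka0 _) (hh0 _)
      nlinarith [mul_nonneg (ha0 (C η u)) (kb0 (C (E \ η) u)), mul_nonneg (hb0 (C (E \ η) u)) (ka0 (C η u)), e1]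
    · rw [if_neg hv, if_neg hv, if_neg hv]; linarith
  have eA : ∑ η ∈ Q.powerset, (if 𝒱 η then fA η * fC η else 0) = ∑ η ∈ Q.powerset, (if 𝒱 η then h (S (η ∪ W)) * k (S (η ∪ W)) else 0) := rfl
  have eD : ∑ η ∈ Q.powerset, (if 𝒱 η ∧ b ∉ C η u then (fa η - hb (C (E \ η) u)) * (fc η - kb (C (E \ η) u)) else 0)
      = ∑ η ∈ Q.powerset, (if 𝒱 η ∧ b ∉ C η u then (ha (C η u) - hb (C (E \ η) u)) * (ka (C η u) - kb (C (E \ η) u)) else 0) := rfl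
  rw [hsplit] at slack'
  rw [← eA, ← eD]
  linarith [slack', hsplit2, hph]

end Coefficientwise

end Summit.CriticalPhenomena.PercolationContinuityZ3.Theorems
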